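import Summits.PneNP.PneNP.Theorems.SymmetryBudgetWindowCanoniserComplete2
import Summits.PneNP.PneNP.Theorems.SymmetryBudgetWindowCanoniserSymmetry
import Summits.PneNP.PneNP.Theorems.SymmetryBudgetWindowCanoniserSize
import Summits.PneNP.PneNP.Theorems.SymmetryBudgetNoHiddenOrderOfGraphCanonisation

/-!
# Window canoniser, XXX: completeness III, assembly, and `NoHiddenOrder`

Route `PneNP/SymmetryBudget`, dichotomy `WindowBarrier` (stmt-PneNP-2145) / `NoHiddenOrder` (stmt-PneNP-14781);
continuation of `…WindowCanoniserComplete2.lean`, `…Symmetry.lean`, `…Size.lean`.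
* Completeness III: by induction on the measure of labels, **every reached label reports a value**
  (`WCan.nbp_of_good`); with soundness, **the root label reports the data of a valid ordering of the window**
  (`WCan.root_bits`).
* Assembly: the canonical form `WCan.CF K x` has, entry by entry, a `Bud`-symmetric `tcBasis` circuit of size
  `|Node K r n| ≤ sizePoly K (m)` (`WCan.hasSymCircuit_CF`), and its graph is the graph of the relabelling of `x` by a
  member of the budget (`WCan.CF_graph`).  Packaged at every `m ≥ 4` with window `n = ⌊log₂ m⌋` and `K = 16`:
  `WCan.canoniser`, the hypothesis of `noHiddenOrder_of_entrywiseCanoniser`.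
* Hence **`NoHiddenOrder` holds** (`NoHiddenOrder_proof`): every `Bud`-invariant polynomial-time graph property has
  polynomial-size `Bud`-symmetric threshold circuits.
-/

-- `Summit.PneNP.PneNP.…` duplicates `PneNP` BY DESIGN (single-problem summit, D-0017 layout).
set_option linter.dupNamespace false

noncomputable section

namespace Summit.PneNP.PneNP.Theorems

namespace WCan

open Finset Equiv Literature.Computability.Complexity Literature.Computability.Complexity.CGCanon
  Literature.Combinatorics.SimpleGraph ColourRefinementScheme
open scoped Classical

section Completeness

variable {K r n : ℕ} [NeZero n] {x : Fin (r + n) × Fin (r + n) → Bool} (hn : 2 ≤ n) (hK : B₀ n ≤ K * n)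

/-! ### Every reached label reports -/

include hn hK in
/-- **Every reached (admissible) label reports a value.** -/
theorem nbp_of_good (L : Lab K n) (t : ℕ) (g : Good L.1 x t) (z : Fin n) : NBP (r := r) L x z := by
  induction hM : L.1.M using Nat.strong_induction_on generalizing L t z with
  | _ M ih =>
    have IH : ∀ Lc : Lab K n, Lc.1.M < L.1.M → ∀ t', Good Lc.1 x t' → ∀ z', NBP (r := r) Lc x z' :=
      fun Lc hlt t' g' z' => ih Lc.1.M (hM ▸ hlt) Lc t' g' z' rfl
    rw [NBP_iff hn]
    by_cases hU : L.1.U.card ≤ 1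
    · exact Or.inl hU
    right
    obtain ⟨hWf, hcf, -⟩ := g.finSt_eq
    have hWt := g.now.1
    have hiff : IsConn (G x) (finSt L.1 x).W (finSt L.1 x).c ↔ IsConn (G x) (rs L.1 x t).W (rs L.1 x t).c := by
      rw [hWf, hcf, hWt]
    by_cases hconn : IsConn (G x) (rs L.1 x t).W (rs L.1 x t).c
    · -- individualisation node: the candidate child of a vertex of the branching cell
      left
      refine ⟨hiff.2 hconn, ?_⟩
      have hW2 : 2 ≤ (rs L.1 x t).W.card := by rw [hWt]; omega
      obtain ⟨u, hu⟩ : (rs L.1 x t).W.Nonempty := card_pos.1 (by omega)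
      obtain ⟨xv, hxv⟩ := bigMinCell_nonempty ⟨u, hu, g.equi.two_le_card_cell hconn hW2 hu⟩
      have gc := good_cand g hU hconn hxv
      have hxX := xv_notin_X g hxv
      let Lc : Lab K n := ⟨candL L.1 x t xv, gc.mem_admSet hK⟩
      have hcand : candLab L xv (hgt L.1 x t) = some Lc := by
        unfold candLab
        rw [dif_pos ⟨hxX, gc.mem_admSet hK⟩]
      refine ⟨(xv, hgt L.1 x t), ?_⟩
      rw [certP, ev_aCert_inl hn, decide_eq_true_iff]
      refine ⟨Lc, hcand, ⟨t, g.t_lt_T, ?_, ?_, fun _ => ?_⟩, gc.okP, IH Lc (M_candLab_lt L hcand) (t + 1) gc xv⟩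
      · show StEq (rs (candL L.1 x t xv) x t) (finSt L.1 x)
        rw [traj_cand g hxv le_rfl]; exact g.stEq_finSt
      · show ¬ frzP (candL L.1 x t xv) (rs (candL L.1 x t xv) x t)
        rw [traj_cand g hxv le_rfl]; exact not_frz_cand g hxX le_rfl
      · show xv ∈ selSet (candL L.1 x t xv) (rs (candL L.1 x t xv) x t)
        rw [traj_cand g hxv le_rfl, selSet_cand_t g hxv]; exact mem_singleton_self _
    · -- section node: every part child
      right
      refine ⟨fun h => hconn (hiff.1 h), fun u hu => ?_⟩
      rw [ev_aPcov hn, decide_eq_true_iff]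
      have hKf : Kf L x u = comp (G x) (rs L.1 x t).W (rs L.1 x t).c u := by
        show comp (G x) (finSt L.1 x).W (finSt L.1 x).c u = _; rw [hWf, hcf, hWt]
      have gp := good_part g hU hconn hu
      have hss := part_ssubset (u := u) g hconn
      have huW : u ∈ (rs L.1 x t).W := hWt.symm ▸ hu
      let Lp : Lab K n := ⟨partL L.1 x t u, gp.mem_admSet hK⟩
      have hpart : partLab L (comp (G x) (rs L.1 x t).W (rs L.1 x t).c u) = some Lp := by
        unfold partLab
        rw [if_pos ⟨hss, ⟨u, mem_comp_self huW⟩⟩]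
      refine ⟨Kf L x u, ⟨hu, hKf ▸ hss, ⟨u, mem_comp_self (hWf.symm ▸ hu)⟩, fun v => ?_⟩, ?_⟩
      · rw [mem_comp, hWf]
        exact ⟨fun h => ⟨hu, h.2⟩, fun h => ⟨mem_of_reachable hu h.2, h.2⟩⟩
      · rw [certS, ev_aCert_inr hn, decide_eq_true_iff, hKf]
        refine ⟨Lp, hpart, ⟨t, g.t_lt_T, ?_, ?_, fun h => absurd h (by decide)⟩, gp.okP, IH Lp (M_partLab_lt L hpart) (t + 1) gp u⟩
        · show StEq (rs (partL L.1 x t u) x t) (finSt L.1 x)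
          rw [traj_part g hconn hu le_rfl]; exact g.stEq_finSt
        · show ¬ frzP (partL L.1 x t u) (rs (partL L.1 x t u) x t)
          rw [traj_part g hconn hu le_rfl]; exact not_frz_part g hss le_rfl

/-! ### The root -/

omit [NeZero n] in
/-- The root label of the tree is the root label of the replay. -/
theorem root_val (K n : ℕ) : (Lab.root K n).1 = rootLab n := rfl

include hn hK in
/-- **The root reports**: its replay is OK and its group reports a value. -/
theorem root_ok_nbp (x : Fin (r + n) × Fin (r + n) → Bool) (z : Fin n) : okP (Lab.root K n).1 x ∧ NBP (r := r) (Lab.root K n) x z :=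
  ⟨(good_root x).okP, nbp_of_good hn hK (Lab.root K n) 0 (good_root x) z⟩

include hn hK in
/-- **Completeness with soundness: the value bits of the root are the data of a valid ordering of the whole
window.** -/
theorem root_bits (x : Fin (r + n) × Fin (r + n) → Bool) :
    ∃ ord, ValidOrd (univ : Finset (Fin n)) ord ∧
      ∀ z' b, ev x (aVbit (r := r) (Lab.root K n) z' b) = true ↔ Data (rootLab n) x ord (bdec b) := by
  obtain ⟨hok, hnbp⟩ := root_ok_nbp (r := r) hn hK x ⟨0, NeZero.pos n⟩
  exact sound hn (Lab.root K n) hok _ hnbp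

end Completeness

variable {K r n : ℕ} [NeZero n]

/-! ### The output gates -/

/-- An output gate is the `∨` over the ambient vertices of the root's value bit. -/
theorem ev_outv (x : Fin (r + n) × Fin (r + n) → Bool) (b : Fin (NB r n)) :
    ev x (Atom.outv (K := K) b) = true ↔ ∃ z : Fin n, ev x (aVbit (Lab.root K n) z b) = true := by
  show Vl K x _ = true ↔ _
  rw [Vl_eq]
  show (GateFn.or n).2 (fun i => GateDAG.wire x (Vl K x) (Atom.args (Atom.outv (K := K) (r := r) b) i)) = true ↔ _
  simp [GateFn.or, Atom.args]

/-- The canonical form, read off the output wire. -/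
theorem CF_apply (x : Fin (r + n) × Fin (r + n) → Bool) (a b : Fin (r + n)) :
    CF K x (a, b) = GateDAG.wire x (Vl K x) (outW K a b) := rfl

omit [NeZero n] in
/-- Decoding an outside index. -/
@[simp] theorem finSumFinEquiv_symm_ov (o : Fin r) : finSumFinEquiv.symm (ov n o) = Sum.inl o :=
  finSumFinEquiv_symm_apply_castAdd o

omit [NeZero n] in
/-- Decoding a window index. -/
@[simp] theorem finSumFinEquiv_symm_wv (i : Fin n) : finSumFinEquiv.symm (wv r i) = Sum.inr i :=
  finSumFinEquiv_symm_apply_natAdd i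

section Graph

variable {x : Fin (r + n) × Fin (r + n) → Bool} {ord : ℕ → Fin n}
  (hdata : ∀ z' b, ev x (aVbit (r := r) (Lab.root K n) z' b) = true ↔ Data (rootLab n) x ord (bdec b))
include hdata

omit hdata in
/-- Entries between two outside indices: the symmetrised input, off the diagonal. -/
theorem CF_ov_ov (o o' : Fin r) : CF K x (ov n o, ov n o') = true ↔ o ≠ o' ∧ (x (ov n o, ov n o') = true ∨ x (ov n o', ov n o) = true) := by
  rw [CF_apply, outW]
  simp only [finSumFinEquiv_symm_ov]
  split_ifs with h
  · simp [h]
  · rw [wire_wA, ev_oo]; simp [h]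

/-- Entries between an outside index and a window position: the outside bit of the vertex there. -/
theorem CF_ov_wv (o : Fin r) (p : Fin n) : CF K x (ov n o, wv r p) = true ↔ xo x (ord p) o = true := by
  rw [CF_apply, outW]
  simp only [finSumFinEquiv_symm_ov, finSumFinEquiv_symm_wv, wire_wA, ev_outv, hdata, bdec_benc, Data, rootLab, card_univ,
    Fintype.card_fin, Fin.is_lt, true_and, exists_const]

/-- Symmetrically. -/
theorem CF_wv_ov (p : Fin n) (o : Fin r) : CF K x (wv r p, ov n o) = true ↔ xo x (ord p) o = true := by
  rw [CF_apply, outW]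
  simp only [finSumFinEquiv_symm_ov, finSumFinEquiv_symm_wv, wire_wA, ev_outv, hdata, bdec_benc, Data, rootLab, card_univ,
    Fintype.card_fin, Fin.is_lt, true_and, exists_const]

/-- Entries between two window positions: adjacency of the vertices there. -/
theorem CF_wv_wv (p q : Fin n) : CF K x (wv r p, wv r q) = true ↔ (G x).Adj (ord p) (ord q) := by
  rw [CF_apply, outW]
  simp only [finSumFinEquiv_symm_wv, wire_wA, ev_outv, hdata, bdec_benc, Data, rootLab, card_univ, Fintype.card_fin, Fin.is_lt,
    true_and, exists_const]

end Graph

/-! ### The graph of the canonical form -/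

omit [NeZero n] in
/-- Outside and window indices differ. -/
theorem ov_ne_wv (o : Fin r) (i : Fin n) : ov n o ≠ wv r i := by
  intro h; have := congrArg Fin.val h; simp [ov, wv, Fin.castAdd, Fin.natAdd] at this; omega

omit [NeZero n] in
/-- `wv` is injective. -/
theorem wv_inj {i j : Fin n} : wv r i = wv r j ↔ i = j := by
  constructor
  · intro h; have := congrArg Fin.val h; simp [wv] at this; exact Fin.ext this
  · rintro rfl; rfl

omit [NeZero n] in
/-- `ov` is injective. -/
theorem ov_inj {o o' : Fin r} : ov n o = ov n o' ↔ o = o' := by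
  constructor
  · intro h; have := congrArg Fin.val h; simp [ov] at this; exact Fin.ext this
  · rintro rfl; rfl

/-- **The graph of the canonical form is the graph of a budget relabelling of the input.** -/
theorem CF_graph (hn : 2 ≤ n) (hK : B₀ n ≤ K * n) (x : Fin (r + n) × Fin (r + n) → Bool) :
    ∃ ρ ∈ pointStabiliserBudget (r + n) n,
      (SimpleGraph.fromRel fun u v => CF K x (u, v) = true) = SimpleGraph.fromRel fun u v => x (ρ u, ρ v) = true := by
  obtain ⟨ord, hvalid, hdata⟩ := root_bits (K := K) (r := r) hn hK x
  -- the ordering as a permutation of the window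
  have hcard : (univ : Finset (Fin n)).card = n := by simp
  let f : Fin n → Fin n := fun p => ord p
  have hinj : Function.Injective f := fun p q h =>
    Fin.ext (hvalid.2.1 p q (by rw [hcard]; exact p.2) (by rw [hcard]; exact q.2) h)
  have hbij : Function.Bijective f := ⟨hinj, Finite.surjective_of_injective hinj⟩
  let π : Perm (Fin n) := Equiv.ofBijective f hbij
  have hπ : ∀ p, π p = ord p := fun p => rfl
  refine ⟨extPerm r π, extPerm_mem_budget π, ?_⟩
  ext u v
  simp only [SimpleGraph.fromRel_adj, ne_eq]
  rcases eq_wv_or_eq_ov u with ⟨o, rfl⟩ | ⟨p, rfl⟩ <;> rcases eq_wv_or_eq_ov v with ⟨o', rfl⟩ | ⟨q, rfl⟩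
  · simp only [CF_ov_ov, extPerm_ov, ne_eq, ov_inj]
    tauto
  · simp only [CF_ov_wv hdata, CF_wv_ov hdata, extPerm_ov, extPerm_wv, hπ, xo, Bool.or_eq_true]
    tauto
  · simp only [CF_ov_wv hdata, CF_wv_ov hdata, extPerm_ov, extPerm_wv, hπ, xo, Bool.or_eq_true]
    tauto
  · simp only [CF_wv_wv hdata, extPerm_wv, hπ, G_adj, wv_inj, ne_eq]
    have : ord p = ord q ↔ p = q := ⟨fun h => hinj h, fun h => by rw [h]⟩
    rw [this]
    constructor
    · rintro ⟨hpq, h⟩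
      refine ⟨hpq, ?_⟩
      rcases h with ⟨-, h⟩ | ⟨-, h⟩
      · exact h
      · exact h.symm
    · rintro ⟨hpq, h⟩
      exact ⟨hpq, Or.inl ⟨hpq, h⟩⟩

/-! ### The symmetric circuits -/

/-- **Every entry of the canonical form has a budget-symmetric threshold circuit of size `|Node K r n|`.** -/
theorem hasSymCircuit_CF (a b : Fin (r + n)) :
    HasSymCircuit tcBasis (pointStabiliserBudget (r + n) n) (Fintype.card (Node K r n)) fun x => CF K x (a, b) :=
  ⟨(wDAG K r n (outW K a b)).compile, compile_isOver _, (compile_size _).le, compile_isSymmetricUnder a b, compile_computes_CF a b⟩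

/-! ### Packaging at every input size -/

/-- **The window canoniser at window size `n ≥ 2` and outside size `r`** (`K = 16`). -/
theorem canoniser_rn (r n : ℕ) [NeZero n] (hn : 2 ≤ n) (s : ℕ) (hs : Fintype.card (Node 16 r n) ≤ s) :
    ∃ CF' : (Fin (r + n) × Fin (r + n) → Bool) → (Fin (r + n) × Fin (r + n) → Bool),
      (∀ q₀, HasSymCircuit tcBasis (pointStabiliserBudget (r + n) n) s fun x => CF' x q₀) ∧
      ∀ x, ∃ ρ ∈ pointStabiliserBudget (r + n) n,
        (SimpleGraph.fromRel fun u v => CF' x (u, v) = true) = SimpleGraph.fromRel fun u v => x (ρ u, ρ v) = true := by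
  have hK : B₀ n ≤ 16 * n := B₀_le (by omega)
  exact ⟨CF 16, fun q₀ => (hasSymCircuit_CF q₀.1 q₀.2).mono hs, CF_graph hn hK⟩

omit [NeZero n] in
/-- **THE CANONISER.**  At every `m ≥ 4`, with window `n = ⌊log₂ m⌋`: a canonical form with entrywise
`Bud_m(⌊log₂ m⌋)`-symmetric `tcBasis` circuits of size `sizePoly 16 (m)` whose graph is the graph of a budget
relabelling of the input. -/
theorem canoniser (m : ℕ) (hm : 4 ≤ m) :
    ∃ CF' : (Fin m × Fin m → Bool) → (Fin m × Fin m → Bool),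
      (∀ q₀, HasSymCircuit tcBasis (pointStabiliserBudget m (Nat.log 2 m)) ((sizePoly 16).eval m) fun x => CF' x q₀) ∧
      ∀ x, ∃ ρ ∈ pointStabiliserBudget m (Nat.log 2 m),
        (SimpleGraph.fromRel fun u v => CF' x (u, v) = true) = SimpleGraph.fromRel fun u v => x (ρ u, ρ v) = true := by
  obtain ⟨n, hn'⟩ : ∃ n, Nat.log 2 m = n := ⟨_, rfl⟩
  have hn2 : 2 ≤ n := by rw [← hn']; exact Nat.le_log_of_pow_le (by norm_num) (by simpa using hm)
  have hnm : n ≤ m := by rw [← hn']; exact Nat.log_le_self 2 m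
  obtain ⟨r, rfl⟩ : ∃ r, m = r + n := ⟨m - n, by omega⟩
  rw [hn']
  haveI : NeZero n := ⟨by omega⟩
  exact canoniser_rn r n hn2 _ (card_Node_le_eval 16 r n (r + n) rfl (by rw [hn']))

end WCan

open Filter Summit.PneNP.PneNP.Theses.SymmetryBudget

/-- **`NoHiddenOrder` holds** (route `PneNP/SymmetryBudget`): the window canoniser at every `m ≥ 4`. -/
theorem NoHiddenOrder_proof : NoHiddenOrder :=
  noHiddenOrder_of_entrywiseCanoniser (WCan.sizePoly 16) (eventually_atTop.2 ⟨4, fun m hm => WCan.canoniser m hm⟩)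

end Summit.PneNP.PneNP.Theorems

end
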